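import Literature.NumberTheory.GaloisRepresentations.HeckeCharacterRamificationProofs
import HarnessLib

/-!
# Hecke characters are unramified at almost all places — the filter form (proof file)

Sibling proof file of `Literature/NumberTheory/GaloisRepresentations/HeckeCharacter.lean`.  That
module vendors Tate's Lemma 3.2.1 for the idele class quasi-character `χ` of a number field `K`
in two definitionally equivalent forms (`HeckeCharacter.finite_ramifiedPlaces_iff`, Mathlib
`Filter.eventually_cofinite`):

* `HeckeCharacter.finite_ramifiedPlaces χ` — `χ.ramifiedPlaces` is finite — discharged in
  `HeckeCharacterRamificationProofs.lean` (`HeckeCharacter.finite_ramifiedPlaces_holds`, the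
  printed proof: no small subgroups of `ℂˣ` + `localUnits v (𝒪_vˣ) → 1` cofinitely in `v`);
* `HeckeCharacter.isUnramifiedAt_cofinite χ` — `∀ᶠ v in cofinite, χ.IsUnramifiedAt v` — which
  this file **discharges** (`HeckeCharacter.isUnramifiedAt_cofinite_holds`) by transporting the
  first along `finite_ramifiedPlaces_iff`, so that both vendored forms are theorems of the tree.

Nothing else is here; the mathematics is in `HeckeCharacterRamificationProofs.lean`.

## References

* J. Tate, *Fourier analysis in number fields and Hecke's zeta-functions* (thesis, 1950), in
  Cassels–Fröhlich, *Algebraic Number Theory* (1967), Ch. XV, §3.2, Lemma 3.2.1 (a quasi-character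
  of a restricted direct product is trivial on `H_𝔭` for almost all `𝔭`), applied to `𝕀_K` in
  §4.3. [TateThesis1967]
* J. Neukirch, *Algebraic Number Theory*, Ch. VII §6, proof of Prop. (6.12).
-/

noncomputable section

open NumberField IsDedekindDomain

namespace Literature.NumberTheory.GaloisRepresentations

namespace HeckeCharacter

universe u

variable {K : Type u} [Field K] [NumberField K]

/-- **Discharge** of the named fact `HeckeCharacter.isUnramifiedAt_cofinite`: every Hecke
character `χ` of `K` is unramified at all but finitely many finite places,
`∀ᶠ v in cofinite, χ.IsUnramifiedAt v`.  Definitionally this is `finite_ramifiedPlaces χ`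
(`finite_ramifiedPlaces_iff`), proved as `finite_ramifiedPlaces_holds`.
Ref: Tate (1950), Lemma 3.2.1 (Cassels–Fröhlich, Ch. XV, §3.2), applied to `𝕀_K` in §4.3;
Neukirch, *Algebraic Number Theory*, Ch. VII §6, proof of Prop. (6.12).
[cite: TateThesis1967, Lemma 3.2.1] -/
theorem isUnramifiedAt_cofinite_holds :
    ∀ χ : HeckeCharacter K, χ.isUnramifiedAt_cofinite :=
  fun χ => χ.finite_ramifiedPlaces_iff.mp (finite_ramifiedPlaces_holds χ)

end HeckeCharacter

end Literature.NumberTheory.GaloisRepresentations
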